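import Summits.CriticalPhenomena.SAWScalingLimit.Theses.SAWGaussianRotation
import Summits.CriticalPhenomena.SAWScalingLimit.Theses.SAWRestrictionRigidity
import Literature.Probability.RandomPlanarGeometry.SAWScalingLimitFamily
import Literature.Probability.RandomPlanarGeometry.ChordalReversibility
import Literature.Probability.RandomPlanarGeometry.LatticeSimilarityCovariance
import Literature.Probability.RandomPlanarGeometry.ChordalRestrictionMarkov
import Summits.CriticalPhenomena.SAWScalingLimit.Theorems.SAWRestrictionRigidityAxiomsOfLimitSoftConjuncts
import Summits.CriticalPhenomena.SAWScalingLimit.Theorems.SAWRestrictionRigidityAxiomsOfLimitKernelClauseBookkeeping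
import Summits.CriticalPhenomena.SAWScalingLimit.Theorems.SAWRestrictionRigidityAxiomsOfLimitMarkovMarkovExtensionOfLimit
import Summits.CriticalPhenomena.SAWScalingLimit.Theorems.SAWRestrictionRigidityAxiomsOfLimitKernelClausePerF
import HarnessLib

/-!
# Line `split` — skeleton of the crux `AxiomsOfLimit` (stmt-CriticalPhenomena-1370), lead's reshape r3 (lead c5; r1 = lead c1, r2 = lead c5 18:25Z, docstring state r5 = lead c4)

`AxiomsOfLimit` (shared verbatim by six SAW routes; primary decl `SAWRestrictionRigidity.AxiomsOfLimit`)
says that every chordal family `P` which is the FULL scaling limit `(lim)` of the critical `δℤ²`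
self-avoiding walk — for every Dobrushin domain and every endpoint approximation, i.e.
`SAW.IsScalingLimitFamily P` — satisfies the six lattice-exact axioms consumed by the rigidity cruxes:

  (i) restriction · (ii) a restriction-coupled domain-Markov kernel · (iii) reversibility ·
  (iv) covariance under the lattice similarities `z ↦ r·iᵏ·z + w` · (v) covariance under `z ↦ z̄` ·
  (vi) a.s. simple curves meeting `∂D` only at the marked points.

## Reshape r1 (lead prover-line-stmt-CriticalPhenomena-1370-c1-0, 2026-08-17) of the strategist's `split`

The strategist's `Lines/split.lean` (sha 336eeac87523) PROVED the soft conjuncts (iii) and (v) inside the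
skeleton and took (iv) from the landed item stmt-7306. A skeleton is a composition record, and proofs
belong under `Theorems/`: this reshape moves them OUT into the landed support file
`Theorems/SAWRestrictionRigidityAxiomsOfLimitSoftConjuncts.lean` (namespace
`Summit.CriticalPhenomena.SAWScalingLimit.Theorems.AxiomsOfLimitSoft`: `isReversible_of_isScalingLimitFamily`,
`conj_eq_of_isScalingLimitFamily`, `isLatticeSimilarityCovariant_of_isScalingLimitFamily`, and the glue
`axiomsOfLimit_of_subs` for all six route copies), which proves the registered stub
`stub_latticeSymmetryPassage` (= S1 of the earlier line `birth`) BY NAME (registered 2026-08-17T05:30Z, landed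
p143694 05:37Z: `∀ P, SAW.IsScalingLimitFamily P → P.IsReversible ∧ P.IsLatticeSimilarityCovariant`, i.e.
(iii) ∧ ((iv) ∧ (v)) bundled — definitionally the three conjuncts; exact lattice symmetries + uniqueness
of weak limits, LSW04 §3.1, Beffara 2008 Prop. 4). With S0 CLOSED and used by its landed name inside
`AxiomsOfLimit_of`, the skeleton is a pure composition over the THREE remaining registered stubs:

* `stub_simpleOfLimit` = (vi) — verbatim the shared open crux stmt-CriticalPhenomena-0774.
* `stub_restrictionOfLimit` = (i) — verbatim the shared open crux stmt-CriticalPhenomena-0773.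
* `stub_markovOfLimit` = (ii) GIVEN (i) and (vi) — the restriction-coupled Markov kernel of the limit
  (the strategist's proposed split child `MarkovOfLimit`, verbatim; HARDEST; held by the lead).

`AxiomsOfLimit_of : stub_simpleOfLimit → stub_restrictionOfLimit → stub_markovOfLimit →
SAWRestrictionRigidity.AxiomsOfLimit` (NO `sorry` of its own; S0 enters by its landed name; conclusion = the item's
primary decl BY NAME; `AxiomsOfLimit_of_gaussianRotation` closes the copy at the line's home route by the
same term; the four other copies — SAWInfinitesimalRigidity, SAWPoissonBanks, SAWRestrictionDescent,
SAWPtolemyBoundary — have syntactically identical bodies and are served by the glue theorems of the support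
file).

## Reshape r2 (lead prover-line-stmt-CriticalPhenomena-1370-c5-0, 2026-08-17): the Markov stub in its a.e. form

Lead c4 proved the `IsMarkovExtension` half of `stub_markovOfLimit` for every full scaling limit given (vi)
(`AxiomsOfLimitMarkov.isMarkovExtension_of_isScalingLimitFamily`, p166172) and isolated the residual: the
restriction-kernel clause `IsRestrictionKernel` (R5), quantified over ALL pasts. Lead c5 landed the bookkeeping
theorem c4 asked for, `AxiomsOfLimitKernelClause.isRestrictionMarkov_of_ae_kernelClause` (p172206): restriction (i) +
a Markov extension `Q` + the clause at the past `γ.stopAt F` for `P D`-a.e. `γ`, for every `D` and every closed `F`,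
already give `P.IsRestrictionMarkov` (zero the kernel at the configurations where the clause fails: `domain` survives
because clause and kernel are configuration-determined, `initial` because the clause at the trivial past IS (i), `markov`
because the modified pasts are null for every `(D, F)`). Hence the registered Markov stub is REPLACED by its a.e. form
`stub_kernelClauseAE` (same hypotheses; conclusion `∃ Q, P.IsMarkovExtension Q ∧ ∀ D, ∀ closed F, ∀ᵐ γ ∂P D, clause at
γ.stopAt F`), and `markovOfLimit_of_kernelClauseAE : stub_kernelClauseAE → (statement of the old stub_markovOfLimit)` is
PROVED below; `AxiomsOfLimit_of` consumes `stub_simpleOfLimit`, `stub_restrictionOfLimit`, `stub_kernelClauseAE`. What is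
research in `stub_kernelClauseAE`: the clause at `P D`-TYPICAL pasts for cusped pinned sub-domains (census (C2)); its
`∃ Q, IsMarkovExtension` part is c4's theorem, and any measurable Markov extension may serve (a.e. uniqueness of
disintegrations — wave c5 sub-goal).

## Reshape r3 (lead c5, 2026-08-17 ~21:30Z): the Markov stub in its KERNEL-FREE per-stopping-set form

Wave 2 of lead c5 made the kernel of c4's Markov extension a.e.-measurable along every past
(`AxiomsOfLimitKernelClause.stub_isMarkovExtensionAEMOfScalingLimit`: `∃ Q, P.IsMarkovExtension Q ∧` for every `D`,
closed `F`, measurable `T`, `Q D (γ.stopAt F) T` is `P D`-a.e. a measurable function of the past; p173419 soft-Markov AEM,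
p173382 packaging, p173770 composition) and proved a.e. uniqueness of such kernels (`stub_markovKernelAEUnique_aem`,
p173290). Consequently the a.e. clause for SOME Markov extension (`stub_kernelClauseAE`, r2) follows from a statement with
NO Markov extension in it — `stub_kernelClausePerF`: for every `D` and every closed `F` SEPARATELY, some (equivalently:
any) kernel `q` disintegrating the single law `P D` at the single stopping set `F`, a.e.-measurable along the past,
satisfies the restriction-kernel clause at `P D`-a.e. past (`stub_kernelClauseAEOfPerF`, p173770, PROVED). The registered
research stub is now `stub_kernelClausePerF`; `kernelClauseAE_of_perF` and `markovOfLimit_of_kernelClauseAE` are theorems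
of this file; `AxiomsOfLimit_of` consumes `stub_simpleOfLimit`, `stub_restrictionOfLimit`, `stub_kernelClausePerF`.
Research content unchanged and now isolated in its weakest form: a property of the two-piece decomposition
(past `γ.stopAt F`, future `γ.startFrom F`) of ONE law `P D` at ONE closed `F` — the regular conditional law of the future
given the past, conditioned to stay in a pinned Dobrushin sub-domain `D'` of the slit domain, is `P D'`, for a.e. past;
content at cusped `D'` (census (C2)); lattice inputs (DC) + (NH) of idea `sleeve-inheritance`.

References: G. F. Lawler, O. Schramm, W. Werner, *On the scaling limit of planar self-avoiding walk*
(2004), arXiv:math/0204277, §2.2, §2.3, §3.1, §3.4.5; V. Beffara, *Is critical 2D percolation universal?*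
(2008), arXiv:0708.3908, §2.1 Prop. 4; W. Werner, *Lectures on two-dimensional critical percolation*
(2007), §3.2. All [folklore] at the level of statements.
-/

noncomputable section

open MeasureTheory Filter Topology Set
open Literature.Probability.LatticeModels Literature.Probability.RandomPlanarGeometry

/-! ### The stubs of the line `split` (the ONLY `sorry`s of this file: `stub_simpleOfLimit`, `stub_restrictionOfLimit`, `stub_kernelClausePerF`; S0 `stub_latticeSymmetryPassage` is CLOSED — landed p143694; the old `stub_markovOfLimit` and the r2 stub `stub_kernelClauseAE` are the THEOREMS `markovOfLimit_of_kernelClauseAE` / `kernelClauseAE_of_perF`) -/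

namespace Summit.CriticalPhenomena.SAWScalingLimit.Cruxes.AxiomsOfLimit.Split

/-- **Stub = child `SimpleOfLimit`** (verbatim the shared open crux stmt-CriticalPhenomena-0774, with
its own registered skeleton `Cruxes/SimpleOfLimit/Lines/birth.lean`): every chordal full scaling limit
of the critical `δℤ²` SAW is carried by simple curves meeting `∂D` only at the marked points — a
genuine uniform lattice estimate (no macroscopic near-self-touching, no boundary crawling).
[cite: LawlerSchrammWerner2004SAW, §3.4.5] -/
theorem stub_simpleOfLimit :
    ∀ P : Literature.Probability.RandomPlanarGeometry.ChordalFamily, P.IsChordal → (∀ (D : Literature.Probability.RandomPlanarGeometry.DobrushinDomain) (a b : ℝ → Literature.Probability.LatticeModels.Site 2), Literature.Probability.RandomPlanarGeometry.SAW.IsEndpointApprox D a b → Literature.Probability.RandomPlanarGeometry.TendstoLaw (fun δ (γ : Literature.Probability.RandomPlanarGeometry.SAW.DomainSAW D.carrier δ (a δ) (b δ)) => γ.curve) (fun δ => Literature.Probability.RandomPlanarGeometry.SAW.law D.carrier δ (a δ) (b δ)) id (P D)) → ∀ D : Literature.Probability.RandomPlanarGeometry.DobrushinDomain, ∀ᵐ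 γ ∂(P D), γ ∈ Literature.Probability.RandomPlanarGeometry.CurveClass.simple ∧ γ.range ∩ frontier D.carrier ⊆ {D.pt 0, D.pt 1} := by
  sorry

/-- **Stub = child `RestrictionOfLimit`** (verbatim the shared open crux stmt-CriticalPhenomena-0773,
with its own registered skeleton `Cruxes/RestrictionOfLimit/Lines/birth.lean`): two-sided restriction
of every chordal full scaling limit, in product form (exact lattice identity, LSW04 §3.4.5; the content
is the passage: no loss of avoidance mass). [cite: LawlerSchrammWerner2004SAW, §3.4.5] -/
theorem stub_restrictionOfLimit :
    ∀ P : Literature.Probability.RandomPlanarGeometry.ChordalFamily, P.IsChordal → (∀ (D : Literature.Probability.RandomPlanarGeometry.DobrushinDomain) (a b : ℝ → Literature.Probability.LatticeModels.Site 2), Literature.Probability.RandomPlanarGeometry.SAW.IsEndpointApprox D a b → Literature.Probability.RandomPlanarGeometry.TendstoLaw (fun δ (γ : Literature.Probability.RandomPlanarGeometry.SAW.DomainSAW D.carrier δ (a δ) (b δ)) => γ.curve) (fun δ => Literature.Probability.RandomPlanarGeometry.SAW.law D.carrier δ (a δ) (b δ)) id (P D)) → ∀ (D D' : Literature.Probability.RandomPlanarGeometry.DobrushinDomain),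 D'.carrier ⊆ D.carrier → D'.pt 0 = D.pt 0 → D'.pt 1 = D.pt 1 → ∀ T : Set (Literature.Probability.RandomPlanarGeometry.CurveClass ℂ), MeasurableSet T → P D' T * P D (Literature.Probability.RandomPlanarGeometry.CurveClass.rangeSubset (closure D'.carrier)) = P D (T ∩ Literature.Probability.RandomPlanarGeometry.CurveClass.rangeSubset (closure D'.carrier)) := by
  sorry

/-- **Stub = the Markov conjunct in kernel-free, per-stopping-set form (HARDEST; reshape r3, lead c5)**: for every
full scaling limit `P` of the critical `δℤ²` SAW with restriction (i) and simplicity (vi), every Dobrushin `D` and every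
closed `F ⊆ ℂ`, there is a kernel `q` (e.g. a regular conditional distribution of the future `γ.startFrom F` given the
past `γ.stopAt F` under `P D`) which (a) read at the past is `P D`-a.e. a measurable function of the past for each
measurable `T`, (b) disintegrates `P D` at `F`, and (c) satisfies the RESTRICTION-KERNEL CLAUSE at `P D`-a.e. past:
conditioned into any Dobrushin sub-domain `D'` of the slit domain `remainingDomain D (γ.stopAt F)` pinned at the tip and
at `D.pt 1`, the future is `P D'` (product form). By a.e. uniqueness of such kernels (p173290) "some q" = "every q", and
the clause transfers to the AEM Markov extension of `P` (p173770): `kernelClauseAE_of_perF` below; then bookkeeping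
(p172206) gives the restriction-coupled Markov kernel for ALL pasts: `markovOfLimit_of_kernelClauseAE`. Lattice level:
the conditional future given a lattice past IS the critical SAW of the slit graph (LSW04 §2.3) and restriction is exact
(§3.4.5); the research content is the passage at CUSPED pinned sub-domains (census (C2): never a continuity set; every
fixed-domain a.e. statement sees only non-cusped hitting configurations) = lattice access to the conditional future at
the germ of the tip: (DC) domain continuity along sleeves drawn around the lattice past, (NH) near-tip non-hugging
(idea `sleeve-inheritance`; shared with route SAWTipEnvironment). Soft transport available (landed, namespace
`…Theorems.AxiomsOfLimitKernelClause`): trivial past = (i), null event, InheritDown p172530, InheritUp p172672,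
RelativeRestriction p172895 / AEM p173709, AEUnique p172632 / AEM p173290, RangeSplit p172653, Markov/Restriction
lintegral forms p172641 / p172619. [cite: LawlerSchrammWerner2004SAW, §2.3 and §3.4.5] -/
theorem stub_kernelClausePerF :
    ∀ P : Literature.Probability.RandomPlanarGeometry.ChordalFamily, P.IsChordal → (∀ (D : Literature.Probability.RandomPlanarGeometry.DobrushinDomain) (a b : ℝ → Literature.Probability.LatticeModels.Site 2), Literature.Probability.RandomPlanarGeometry.SAW.IsEndpointApprox D a b → Literature.Probability.RandomPlanarGeometry.TendstoLaw (fun δ (γ : Literature.Probability.RandomPlanarGeometry.SAW.DomainSAW D.carrier δ (a δ) (b δ)) => γ.curve) (fun δ => Literature.Probability.RandomPlanarGeometry.SAW.law D.carrier δ (a δ) (b δ)) id (P D)) → P.IsRestriction → (∀ D : Literature.Probability.RandomPlanarGeometry.DobrushinDomain, ∀ᵐ γ ∂(P D), γ ∈ Literature.Probability.RandomPlanarGeometry.CurveClass.simple ∧ γ.range ∩ frontier D.carrier ⊆ {D.pt 0, D.pt 1}) → ∀ (D : Literature.Probability.RandomPlanarGeometry.DobrushinDomain) (F : Set ℂ),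 IsClosed F → ∃ q : Literature.Probability.RandomPlanarGeometry.CurveClass ℂ → MeasureTheory.Measure (Literature.Probability.RandomPlanarGeometry.CurveClass ℂ), (∀ T : Set (Literature.Probability.RandomPlanarGeometry.CurveClass ℂ), MeasurableSet T → ∃ φ : Literature.Probability.RandomPlanarGeometry.CurveClass ℂ → ENNReal, Measurable φ ∧ Filter.Eventually (fun γ : Literature.Probability.RandomPlanarGeometry.CurveClass ℂ => q (γ.stopAt F) T = φ (γ.stopAt F)) (MeasureTheory.ae (P D))) ∧ (∀ S T : Set (Literature.Probability.RandomPlanarGeometry.CurveClass ℂ), MeasurableSet S → MeasurableSet T → P D (Literature.Probability.RandomPlanarGeometry.CurveClass.stopAt F ⁻¹' S ∩ Literature.Probability.RandomPlanarGeometry.CurveClass.startFrom F ⁻¹' T) = MeasureTheory.lintegral ((P D).restrict (Literature.Probability.RandomPlanarGeometry.CurveClass.stopAt F ⁻¹' S)) (fun γ => q (γ.stopAt F) T)) ∧ Filter.Eventually (fun γ : Literature.Probability.RandomPlanarGeometry.CurveClass ℂ => ∀ D' : Literature.Probability.RandomPlanarGeometry.DobrushinDomain, D'.carrier ⊆ Literature.Probability.RandomPlanarGeometry.remainingDomain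 D (γ.stopAt F) → D'.pt 0 = (γ.stopAt F).target → D'.pt 1 = D.pt 1 → ∀ T : Set (Literature.Probability.RandomPlanarGeometry.CurveClass ℂ), MeasurableSet T → P D' T * q (γ.stopAt F) (Literature.Probability.RandomPlanarGeometry.CurveClass.rangeSubset (closure D'.carrier)) = q (γ.stopAt F) (T ∩ Literature.Probability.RandomPlanarGeometry.CurveClass.rangeSubset (closure D'.carrier))) (MeasureTheory.ae (P D)) := by
  sorry

/-- **The a.e. Markov stub of reshape r2 from its kernel-free form** (landed reduction
`AxiomsOfLimitKernelClause.stub_kernelClauseAEOfPerF`, p173770). No `sorry` of its own. [folklore] -/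
theorem kernelClauseAE_of_perF (hK : ∀ P : Literature.Probability.RandomPlanarGeometry.ChordalFamily, P.IsChordal → (∀ (D : Literature.Probability.RandomPlanarGeometry.DobrushinDomain) (a b : ℝ → Literature.Probability.LatticeModels.Site 2), Literature.Probability.RandomPlanarGeometry.SAW.IsEndpointApprox D a b → Literature.Probability.RandomPlanarGeometry.TendstoLaw (fun δ (γ : Literature.Probability.RandomPlanarGeometry.SAW.DomainSAW D.carrier δ (a δ) (b δ)) => γ.curve) (fun δ => Literature.Probability.RandomPlanarGeometry.SAW.law D.carrier δ (a δ) (b δ)) id (P D)) → P.IsRestriction → (∀ D : Literature.Probability.RandomPlanarGeometry.DobrushinDomain, ∀ᵐ γ ∂(P D), γ ∈ Literature.Probability.RandomPlanarGeometry.CurveClass.simple ∧ γ.range ∩ frontier D.carrier ⊆ {D.pt 0, D.pt 1}) → ∀ (D : Literature.Probability.RandomPlanarGeometry.DobrushinDomain) (F : Set ℂ), IsClosed F → ∃ q : Literature.Probability.RandomPlanarGeometry.CurveClass ℂ → MeasureTheory.Measure (Literature.Probability.RandomPlanarGeometry.CurveClass ℂ), (∀ T : Set (Literature.Probability.RandomPlanarGeometry.CurveClass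 ℂ), MeasurableSet T → ∃ φ : Literature.Probability.RandomPlanarGeometry.CurveClass ℂ → ENNReal, Measurable φ ∧ Filter.Eventually (fun γ : Literature.Probability.RandomPlanarGeometry.CurveClass ℂ => q (γ.stopAt F) T = φ (γ.stopAt F)) (MeasureTheory.ae (P D))) ∧ (∀ S T : Set (Literature.Probability.RandomPlanarGeometry.CurveClass ℂ), MeasurableSet S → MeasurableSet T → P D (Literature.Probability.RandomPlanarGeometry.CurveClass.stopAt F ⁻¹' S ∩ Literature.Probability.RandomPlanarGeometry.CurveClass.startFrom F ⁻¹' T) = MeasureTheory.lintegral ((P D).restrict (Literature.Probability.RandomPlanarGeometry.CurveClass.stopAt F ⁻¹' S)) (fun γ => q (γ.stopAt F) T)) ∧ Filter.Eventually (fun γ : Literature.Probability.RandomPlanarGeometry.CurveClass ℂ => ∀ D' : Literature.Probability.RandomPlanarGeometry.DobrushinDomain, D'.carrier ⊆ Literature.Probability.RandomPlanarGeometry.remainingDomain D (γ.stopAt F) → D'.pt 0 = (γ.stopAt F).target → D'.pt 1 = D.pt 1 → ∀ T : Set (Literature.Probability.RandomPlanarGeometry.CurveClass ℂ), MeasurableSet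 T → P D' T * q (γ.stopAt F) (Literature.Probability.RandomPlanarGeometry.CurveClass.rangeSubset (closure D'.carrier)) = q (γ.stopAt F) (T ∩ Literature.Probability.RandomPlanarGeometry.CurveClass.rangeSubset (closure D'.carrier))) (MeasureTheory.ae (P D))) :
    ∀ P : Literature.Probability.RandomPlanarGeometry.ChordalFamily, P.IsChordal → (∀ (D : Literature.Probability.RandomPlanarGeometry.DobrushinDomain) (a b : ℝ → Literature.Probability.LatticeModels.Site 2), Literature.Probability.RandomPlanarGeometry.SAW.IsEndpointApprox D a b → Literature.Probability.RandomPlanarGeometry.TendstoLaw (fun δ (γ : Literature.Probability.RandomPlanarGeometry.SAW.DomainSAW D.carrier δ (a δ) (b δ)) => γ.curve) (fun δ => Literature.Probability.RandomPlanarGeometry.SAW.law D.carrier δ (a δ) (b δ)) id (P D)) → P.IsRestriction → (∀ D : Literature.Probability.RandomPlanarGeometry.DobrushinDomain, ∀ᵐ γ ∂(P D), γ ∈ Literature.Probability.RandomPlanarGeometry.CurveClass.simple ∧ γ.range ∩ frontier D.carrier ⊆ {D.pt 0, D.pt 1}) → ∃ Q : Literature.Probability.RandomPlanarGeometry.DobrushinDomain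 → Literature.Probability.RandomPlanarGeometry.CurveClass ℂ → MeasureTheory.Measure (Literature.Probability.RandomPlanarGeometry.CurveClass ℂ), P.IsMarkovExtension Q ∧ ∀ (D : Literature.Probability.RandomPlanarGeometry.DobrushinDomain) (F : Set ℂ), IsClosed F → Filter.Eventually (fun γ : Literature.Probability.RandomPlanarGeometry.CurveClass ℂ => ∀ D' : Literature.Probability.RandomPlanarGeometry.DobrushinDomain, D'.carrier ⊆ Literature.Probability.RandomPlanarGeometry.remainingDomain D (γ.stopAt F) → D'.pt 0 = (γ.stopAt F).target → D'.pt 1 = D.pt 1 → ∀ T : Set (Literature.Probability.RandomPlanarGeometry.CurveClass ℂ), MeasurableSet T → P D' T * Q D (γ.stopAt F) (Literature.Probability.RandomPlanarGeometry.CurveClass.rangeSubset (closure D'.carrier)) = Q D (γ.stopAt F) (T ∩ Literature.Probability.RandomPlanarGeometry.CurveClass.rangeSubset (closure D'.carrier))) (MeasureTheory.ae (P D)) :=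
  fun P hch hlim hR h6 =>
    Summit.CriticalPhenomena.SAWScalingLimit.Theorems.AxiomsOfLimitKernelClause.stub_kernelClauseAEOfPerF
      P hch hlim hR h6 (hK P hch hlim hR h6)


/-- **The old Markov stub (= split child `MarkovOfLimit`, verbatim) from its a.e. form**: `stub_kernelClauseAE`
and the landed bookkeeping theorem `isRestrictionMarkov_of_ae_kernelClause` (p172206) give the restriction-coupled
domain-Markov kernel for ALL pasts (`P.IsRestrictionMarkov`, unfolded). No `sorry` of its own. [folklore] -/
theorem markovOfLimit_of_kernelClauseAE (hK : ∀ P : Literature.Probability.RandomPlanarGeometry.ChordalFamily, P.IsChordal → (∀ (D : Literature.Probability.RandomPlanarGeometry.DobrushinDomain) (a b : ℝ → Literature.Probability.LatticeModels.Site 2), Literature.Probability.RandomPlanarGeometry.SAW.IsEndpointApprox D a b → Literature.Probability.RandomPlanarGeometry.TendstoLaw (fun δ (γ : Literature.Probability.RandomPlanarGeometry.SAW.DomainSAW D.carrier δ (a δ) (b δ)) => γ.curve) (fun δ => Literature.Probability.RandomPlanarGeometry.SAW.law D.carrier δ (a δ) (b δ)) id (P D)) → P.IsRestriction → (∀ D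 : Literature.Probability.RandomPlanarGeometry.DobrushinDomain, ∀ᵐ γ ∂(P D), γ ∈ Literature.Probability.RandomPlanarGeometry.CurveClass.simple ∧ γ.range ∩ frontier D.carrier ⊆ {D.pt 0, D.pt 1}) → ∃ Q : Literature.Probability.RandomPlanarGeometry.DobrushinDomain → Literature.Probability.RandomPlanarGeometry.CurveClass ℂ → MeasureTheory.Measure (Literature.Probability.RandomPlanarGeometry.CurveClass ℂ), P.IsMarkovExtension Q ∧ ∀ (D : Literature.Probability.RandomPlanarGeometry.DobrushinDomain) (F : Set ℂ), IsClosed F → Filter.Eventually (fun γ : Literature.Probability.RandomPlanarGeometry.CurveClass ℂ => ∀ D' : Literature.Probability.RandomPlanarGeometry.DobrushinDomain, D'.carrier ⊆ Literature.Probability.RandomPlanarGeometry.remainingDomain D (γ.stopAt F) → D'.pt 0 = (γ.stopAt F).target → D'.pt 1 = D.pt 1 → ∀ T : Set (Literature.Probability.RandomPlanarGeometry.CurveClass ℂ), MeasurableSet T → P D' T * Q D (γ.stopAt F) (Literature.Probability.RandomPlanarGeometry.CurveClass.rangeSubset (closure D'.carrier)) = Q D (γ.stopAt F) (T ∩ Literature.Probability.RandomPlanarGeometry.CurveClass.rangeSubset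 (closure D'.carrier))) (MeasureTheory.ae (P D))) :
    ∀ P : Literature.Probability.RandomPlanarGeometry.ChordalFamily, P.IsChordal → (∀ (D : Literature.Probability.RandomPlanarGeometry.DobrushinDomain) (a b : ℝ → Literature.Probability.LatticeModels.Site 2), Literature.Probability.RandomPlanarGeometry.SAW.IsEndpointApprox D a b → Literature.Probability.RandomPlanarGeometry.TendstoLaw (fun δ (γ : Literature.Probability.RandomPlanarGeometry.SAW.DomainSAW D.carrier δ (a δ) (b δ)) => γ.curve) (fun δ => Literature.Probability.RandomPlanarGeometry.SAW.law D.carrier δ (a δ) (b δ)) id (P D)) → P.IsRestriction → (∀ D : Literature.Probability.RandomPlanarGeometry.DobrushinDomain, ∀ᵐ γ ∂(P D), γ ∈ Literature.Probability.RandomPlanarGeometry.CurveClass.simple ∧ γ.range ∩ frontier D.carrier ⊆ {D.pt 0, D.pt 1}) → ∃ Q : Literature.Probability.RandomPlanarGeometry.DobrushinDomain → Literature.Probability.RandomPlanarGeometry.CurveClass ℂ → MeasureTheory.Measure (Literature.Probability.RandomPlanarGeometry.CurveClass ℂ), P.IsMarkovExtension Q ∧ ∀ (D : Literature.Probability.RandomPlanarGeometry.DobrushinDomain)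 (p : Literature.Probability.RandomPlanarGeometry.CurveClass ℂ) (D' : Literature.Probability.RandomPlanarGeometry.DobrushinDomain), D'.carrier ⊆ Literature.Probability.RandomPlanarGeometry.remainingDomain D p → D'.pt 0 = p.target → D'.pt 1 = D.pt 1 → ∀ T : Set (Literature.Probability.RandomPlanarGeometry.CurveClass ℂ), MeasurableSet T → P D' T * Q D p (Literature.Probability.RandomPlanarGeometry.CurveClass.rangeSubset (closure D'.carrier)) = Q D p (T ∩ Literature.Probability.RandomPlanarGeometry.CurveClass.rangeSubset (closure D'.carrier)) := by
  intro P hch hlim hR h6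
  obtain ⟨Q, hQ, hae⟩ := hK P hch hlim hR h6
  exact (Literature.Probability.RandomPlanarGeometry.ChordalFamily.isRestrictionMarkov_iff P).1
    (Summit.CriticalPhenomena.SAWScalingLimit.Theorems.AxiomsOfLimitKernelClause.isRestrictionMarkov_of_ae_kernelClause
      hR hQ hae)


/-! ### Name-keyed aliases of the stub statements (device of `Lines/birth.lean`) -/

/-- The statement of `stub_simpleOfLimit`, as a `Prop`. -/
def SimpleOfLimitStmt : Prop :=
  ∀ P : Literature.Probability.RandomPlanarGeometry.ChordalFamily, P.IsChordal → (∀ (D : Literature.Probability.RandomPlanarGeometry.DobrushinDomain) (a b : ℝ → Literature.Probability.LatticeModels.Site 2), Literature.Probability.RandomPlanarGeometry.SAW.IsEndpointApprox D a b → Literature.Probability.RandomPlanarGeometry.TendstoLaw (fun δ (γ : Literature.Probability.RandomPlanarGeometry.SAW.DomainSAW D.carrier δ (a δ) (b δ)) => γ.curve) (fun δ => Literature.Probability.RandomPlanarGeometry.SAW.law D.carrier δ (a δ) (b δ)) id (P D)) → ∀ D : Literature.Probability.RandomPlanarGeometry.DobrushinDomain, ∀ᵐ γ ∂(P D), γ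 ∈ Literature.Probability.RandomPlanarGeometry.CurveClass.simple ∧ γ.range ∩ frontier D.carrier ⊆ {D.pt 0, D.pt 1}

/-- The statement of `stub_restrictionOfLimit`, as a `Prop`. -/
def RestrictionOfLimitStmt : Prop :=
  ∀ P : Literature.Probability.RandomPlanarGeometry.ChordalFamily, P.IsChordal → (∀ (D : Literature.Probability.RandomPlanarGeometry.DobrushinDomain) (a b : ℝ → Literature.Probability.LatticeModels.Site 2), Literature.Probability.RandomPlanarGeometry.SAW.IsEndpointApprox D a b → Literature.Probability.RandomPlanarGeometry.TendstoLaw (fun δ (γ : Literature.Probability.RandomPlanarGeometry.SAW.DomainSAW D.carrier δ (a δ) (b δ)) => γ.curve) (fun δ => Literature.Probability.RandomPlanarGeometry.SAW.law D.carrier δ (a δ) (b δ)) id (P D)) → ∀ (D D' : Literature.Probability.RandomPlanarGeometry.DobrushinDomain), D'.carrier ⊆ D.carrier → D'.pt 0 = D.pt 0 → D'.pt 1 = D.pt 1 → ∀ T : Set (Literature.Probability.RandomPlanarGeometry.CurveClass ℂ), MeasurableSet T → P D' T * P D (Literature.Probability.RandomPlanarGeometry.CurveClass.rangeSubset (closure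 D'.carrier)) = P D (T ∩ Literature.Probability.RandomPlanarGeometry.CurveClass.rangeSubset (closure D'.carrier))

/-- The statement of `stub_markovOfLimit`, as a `Prop`. -/
def MarkovOfLimitStmt : Prop :=
  ∀ P : Literature.Probability.RandomPlanarGeometry.ChordalFamily, P.IsChordal → (∀ (D : Literature.Probability.RandomPlanarGeometry.DobrushinDomain) (a b : ℝ → Literature.Probability.LatticeModels.Site 2), Literature.Probability.RandomPlanarGeometry.SAW.IsEndpointApprox D a b → Literature.Probability.RandomPlanarGeometry.TendstoLaw (fun δ (γ : Literature.Probability.RandomPlanarGeometry.SAW.DomainSAW D.carrier δ (a δ) (b δ)) => γ.curve) (fun δ => Literature.Probability.RandomPlanarGeometry.SAW.law D.carrier δ (a δ) (b δ)) id (P D)) → P.IsRestriction → (∀ D : Literature.Probability.RandomPlanarGeometry.DobrushinDomain, ∀ᵐ γ ∂(P D), γ ∈ Literature.Probability.RandomPlanarGeometry.CurveClass.simple ∧ γ.range ∩ frontier D.carrier ⊆ {D.pt 0, D.pt 1}) → ∃ Q : Literature.Probability.RandomPlanarGeometry.DobrushinDomain → Literature.Probability.RandomPlanarGeometry.CurveClass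 ℂ → MeasureTheory.Measure (Literature.Probability.RandomPlanarGeometry.CurveClass ℂ), P.IsMarkovExtension Q ∧ ∀ (D : Literature.Probability.RandomPlanarGeometry.DobrushinDomain) (p : Literature.Probability.RandomPlanarGeometry.CurveClass ℂ) (D' : Literature.Probability.RandomPlanarGeometry.DobrushinDomain), D'.carrier ⊆ Literature.Probability.RandomPlanarGeometry.remainingDomain D p → D'.pt 0 = p.target → D'.pt 1 = D.pt 1 → ∀ T : Set (Literature.Probability.RandomPlanarGeometry.CurveClass ℂ), MeasurableSet T → P D' T * Q D p (Literature.Probability.RandomPlanarGeometry.CurveClass.rangeSubset (closure D'.carrier)) = Q D p (T ∩ Literature.Probability.RandomPlanarGeometry.CurveClass.rangeSubset (closure D'.carrier))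

/-- The statement of `stub_kernelClausePerF`, as a `Prop`. -/
def KernelClausePerFStmt : Prop :=
  ∀ P : Literature.Probability.RandomPlanarGeometry.ChordalFamily, P.IsChordal → (∀ (D : Literature.Probability.RandomPlanarGeometry.DobrushinDomain) (a b : ℝ → Literature.Probability.LatticeModels.Site 2), Literature.Probability.RandomPlanarGeometry.SAW.IsEndpointApprox D a b → Literature.Probability.RandomPlanarGeometry.TendstoLaw (fun δ (γ : Literature.Probability.RandomPlanarGeometry.SAW.DomainSAW D.carrier δ (a δ) (b δ)) => γ.curve) (fun δ => Literature.Probability.RandomPlanarGeometry.SAW.law D.carrier δ (a δ) (b δ)) id (P D)) → P.IsRestriction → (∀ D : Literature.Probability.RandomPlanarGeometry.DobrushinDomain, ∀ᵐ γ ∂(P D), γ ∈ Literature.Probability.RandomPlanarGeometry.CurveClass.simple ∧ γ.range ∩ frontier D.carrier ⊆ {D.pt 0, D.pt 1}) → ∀ (D : Literature.Probability.RandomPlanarGeometry.DobrushinDomain) (F : Set ℂ), IsClosed F → ∃ q : Literature.Probability.RandomPlanarGeometry.CurveClass ℂ → MeasureTheory.Measure (Literature.Probability.RandomPlanarGeometry.CurveClass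 ℂ), (∀ T : Set (Literature.Probability.RandomPlanarGeometry.CurveClass ℂ), MeasurableSet T → ∃ φ : Literature.Probability.RandomPlanarGeometry.CurveClass ℂ → ENNReal, Measurable φ ∧ Filter.Eventually (fun γ : Literature.Probability.RandomPlanarGeometry.CurveClass ℂ => q (γ.stopAt F) T = φ (γ.stopAt F)) (MeasureTheory.ae (P D))) ∧ (∀ S T : Set (Literature.Probability.RandomPlanarGeometry.CurveClass ℂ), MeasurableSet S → MeasurableSet T → P D (Literature.Probability.RandomPlanarGeometry.CurveClass.stopAt F ⁻¹' S ∩ Literature.Probability.RandomPlanarGeometry.CurveClass.startFrom F ⁻¹' T) = MeasureTheory.lintegral ((P D).restrict (Literature.Probability.RandomPlanarGeometry.CurveClass.stopAt F ⁻¹' S)) (fun γ => q (γ.stopAt F) T)) ∧ Filter.Eventually (fun γ : Literature.Probability.RandomPlanarGeometry.CurveClass ℂ => ∀ D' : Literature.Probability.RandomPlanarGeometry.DobrushinDomain, D'.carrier ⊆ Literature.Probability.RandomPlanarGeometry.remainingDomain D (γ.stopAt F) → D'.pt 0 = (γ.stopAt F).target → D'.pt 1 = D.pt 1 → ∀ T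 : Set (Literature.Probability.RandomPlanarGeometry.CurveClass ℂ), MeasurableSet T → P D' T * q (γ.stopAt F) (Literature.Probability.RandomPlanarGeometry.CurveClass.rangeSubset (closure D'.carrier)) = q (γ.stopAt F) (T ∩ Literature.Probability.RandomPlanarGeometry.CurveClass.rangeSubset (closure D'.carrier))) (MeasureTheory.ae (P D))

/-- The statement of the r2 stub `stub_kernelClauseAE` (now a theorem), as a `Prop`. -/
def KernelClauseAEStmt : Prop :=
  ∀ P : Literature.Probability.RandomPlanarGeometry.ChordalFamily, P.IsChordal → (∀ (D : Literature.Probability.RandomPlanarGeometry.DobrushinDomain) (a b : ℝ → Literature.Probability.LatticeModels.Site 2), Literature.Probability.RandomPlanarGeometry.SAW.IsEndpointApprox D a b → Literature.Probability.RandomPlanarGeometry.TendstoLaw (fun δ (γ : Literature.Probability.RandomPlanarGeometry.SAW.DomainSAW D.carrier δ (a δ) (b δ)) => γ.curve) (fun δ => Literature.Probability.RandomPlanarGeometry.SAW.law D.carrier δ (a δ) (b δ)) id (P D)) → P.IsRestriction → (∀ D : Literature.Probability.RandomPlanarGeometry.DobrushinDomain, ∀ᵐ γ ∂(P D), γ ∈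 Literature.Probability.RandomPlanarGeometry.CurveClass.simple ∧ γ.range ∩ frontier D.carrier ⊆ {D.pt 0, D.pt 1}) → ∃ Q : Literature.Probability.RandomPlanarGeometry.DobrushinDomain → Literature.Probability.RandomPlanarGeometry.CurveClass ℂ → MeasureTheory.Measure (Literature.Probability.RandomPlanarGeometry.CurveClass ℂ), P.IsMarkovExtension Q ∧ ∀ (D : Literature.Probability.RandomPlanarGeometry.DobrushinDomain) (F : Set ℂ), IsClosed F → Filter.Eventually (fun γ : Literature.Probability.RandomPlanarGeometry.CurveClass ℂ => ∀ D' : Literature.Probability.RandomPlanarGeometry.DobrushinDomain, D'.carrier ⊆ Literature.Probability.RandomPlanarGeometry.remainingDomain D (γ.stopAt F) → D'.pt 0 = (γ.stopAt F).target → D'.pt 1 = D.pt 1 → ∀ T : Set (Literature.Probability.RandomPlanarGeometry.CurveClass ℂ), MeasurableSet T → P D' T * Q D (γ.stopAt F) (Literature.Probability.RandomPlanarGeometry.CurveClass.rangeSubset (closure D'.carrier)) = Q D (γ.stopAt F) (T ∩ Literature.Probability.RandomPlanarGeometry.CurveClass.rangeSubset (closure D'.carrier))) (MeasureTheory.ae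 (P D))

theorem simpleOfLimitStmt_holds : SimpleOfLimitStmt := stub_simpleOfLimit
theorem restrictionOfLimitStmt_holds : RestrictionOfLimitStmt := stub_restrictionOfLimit
theorem kernelClausePerFStmt_holds : KernelClausePerFStmt := stub_kernelClausePerF
/-- The r2 stub is implied by the registered stubs (reshape r3). -/
theorem kernelClauseAEStmt_holds : KernelClauseAEStmt := kernelClauseAE_of_perF stub_kernelClausePerF
/-- The split child `MarkovOfLimit` is implied by the registered stubs (reshape r2). -/
theorem markovOfLimitStmt_holds : MarkovOfLimitStmt :=
  markovOfLimit_of_kernelClauseAE (kernelClauseAE_of_perF stub_kernelClausePerF)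

namespace __Registered

/-- Alias of `SimpleOfLimitStmt` keyed by the registered stub name. -/
abbrev stub_simpleOfLimit : Prop := SimpleOfLimitStmt
/-- Alias of `RestrictionOfLimitStmt` keyed by the registered stub name. -/
abbrev stub_restrictionOfLimit : Prop := RestrictionOfLimitStmt
/-- Alias of `KernelClausePerFStmt` keyed by the registered stub name. -/
abbrev stub_kernelClausePerF : Prop := KernelClausePerFStmt

end __Registered

/-! ### The skeleton theorems (no `sorry` of their own): the three open stubs (+ landed S0) imply the crux, BY NAME -/

/-- **`AxiomsOfLimit` from the line `split`** — the skeleton theorem, concluding the item's primary decl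
`SAWRestrictionRigidity.AxiomsOfLimit` by name (kernel-checked, no `sorry` of its own): bundle
`(chordal, lim)` into `SAW.IsScalingLimitFamily P`, run the simplicity stub (vi), feed restriction (i) and
(vi) to the a.e. Markov stub composed with the bookkeeping theorem (ii), and take (iii), (iv), (v) from the landed S0
`AxiomsOfLimitSoft.stub_latticeSymmetryPassage`. [folklore] -/
theorem AxiomsOfLimit_of (hS : __Registered.stub_simpleOfLimit)
    (hR : __Registered.stub_restrictionOfLimit) (hK : __Registered.stub_kernelClausePerF) :
    Summit.CriticalPhenomena.SAWScalingLimit.Theses.SAWRestrictionRigidity.AxiomsOfLimit := by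
  have hM : MarkovOfLimitStmt := markovOfLimit_of_kernelClauseAE (kernelClauseAE_of_perF hK)
  intro P hch hlim
  have hP : SAW.IsScalingLimitFamily P := ⟨hch, hlim⟩
  -- (vi) simplicity and boundary avoidance of the limit (stub / child `SimpleOfLimit`)
  have hs := hS P hch hlim
  -- (i) restriction of the limit (stub / child `RestrictionOfLimit`; literally `P.IsRestriction`)
  have hr : P.IsRestriction := hR P hch hlim
  -- (ii) the restriction-coupled Markov kernel, fed with (i) and (vi): per-F stub + AEM reduction (p173770) + bookkeeping (p172206)
  obtain ⟨Q, hQ, hK⟩ := hM P hch hlim hr hs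
  -- (iii) reversibility, (iv) lattice similarities, (v) conjugation: S0, CLOSED (landed p143694)
  obtain ⟨hrev, hlat⟩ :=
    Summit.CriticalPhenomena.SAWScalingLimit.Theorems.AxiomsOfLimitSoft.stub_latticeSymmetryPassage P hP
  exact ⟨hr, ⟨Q, hQ, hK⟩, hrev, hlat.1, hlat.2, hs⟩

/-- **`AxiomsOfLimit` from the line `split`, at route SAWGaussianRotation** (same term; the six copies
of the crux have syntactically identical bodies). [folklore] -/
theorem AxiomsOfLimit_of_gaussianRotation (hS : __Registered.stub_simpleOfLimit)
    (hR : __Registered.stub_restrictionOfLimit) (hK : __Registered.stub_kernelClausePerF) :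
    Summit.CriticalPhenomena.SAWScalingLimit.Theses.SAWGaussianRotation.AxiomsOfLimit := by
  have hM : MarkovOfLimitStmt := markovOfLimit_of_kernelClauseAE (kernelClauseAE_of_perF hK)
  intro P hch hlim
  have hP : SAW.IsScalingLimitFamily P := ⟨hch, hlim⟩
  have hs := hS P hch hlim
  have hr : P.IsRestriction := hR P hch hlim
  obtain ⟨Q, hQ, hK⟩ := hM P hch hlim hr hs
  obtain ⟨hrev, hlat⟩ :=
    Summit.CriticalPhenomena.SAWScalingLimit.Theorems.AxiomsOfLimitSoft.stub_latticeSymmetryPassage P hP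
  exact ⟨hr, ⟨Q, hQ, hK⟩, hrev, hlat.1, hlat.2, hs⟩

/-- Wiring check: the registered stubs feed the skeleton theorem as stated. -/
example : Summit.CriticalPhenomena.SAWScalingLimit.Theses.SAWRestrictionRigidity.AxiomsOfLimit :=
  AxiomsOfLimit_of stub_simpleOfLimit stub_restrictionOfLimit stub_kernelClausePerF

end Summit.CriticalPhenomena.SAWScalingLimit.Cruxes.AxiomsOfLimit.Split

end
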